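import Summits.ResolutionOfSingularities.ResolutionOfSingularities.Theorems.DeltaCutSepCells
import Literature.AlgebraicGeometry.Resolution.OneDimensionalBlowupTowerProof
import Literature.AlgebraicGeometry.Resolution.PointBlowupIntersectionMultiplicityFinite
import Literature.AlgebraicGeometry.Resolution.StrictTransformSupport
import Literature.AlgebraicGeometry.Resolution.AlterationsNodalBoundary
import Literature.AlgebraicGeometry.Resolution.HilbertSamuelIsolatedSingularities
import Literature.AlgebraicGeometry.Resolution.BlowupReducedDimension
import Literature.AlgebraicGeometry.Resolution.RegularHomReduced
import Literature.AlgebraicGeometry.Resolution.QuasiExcellentSchemes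
import Literature.AlgebraicGeometry.Resolution.QuasiExcellentCurveDelta
import Literature.AlgebraicGeometry.Resolution.MonomialOrderReductionUnit
import Literature.AlgebraicGeometry.Resolution.ResolutionOfCurves
import Literature.Topology.KrullDimensionDrop
import HarnessLib

/-!
# DeltaCutRef — decomp-res node «RefCut» (lens-6 g27, critic row 204 CLEARED (F-curve WHOLE) DECIDED +1 · MAP 0),
tree file 1/5 of the node

Content VERBATIM from the decomp-res lens-6 g27 node `HOME/decomp-res-lens-6/g27/RefCut.lean` (pin df7099b8, 1323 l;
HOME = run/shared/lean/pub/decomp-res; companion certificate file `RefCutCertificates.lean` 745ed495 lands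
separately as `DeltaCutRefCertificates*`): NO carry — the node imports the LANDED tree only
(`Theorems.DeltaCutSepCells` = g26 «SepCut», landed by writer g12) + ELEVEN load-bearing
`Literature.AlgebraicGeometry.Resolution.*` files + `Literature.Topology.KrullDimensionDrop` + `HarnessLib` (the
lens checked each Literature import is needed: NEXT-g28.md §4); every declaration is new, same namespace
`…Theorems.DeltaCutClasses` (no collision with the landed files of that namespace — checked by name at staging).
Farm (node; lens + critic runs): rc 0 · 0 err · 0 warn · 0 sorry; axioms {propext, Classical.choice, Quot.sound} (93
`#print axioms` guards in the HOME-only `bc/Probe.lean` 84784e1c).  Critic: CRITIC-LEDGER row 204 «RefCut» CLEARED —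
(F-curve WHOLE) DECIDED +1 ONCE in TREE CURRENCY · MAP 0 (window row 196, all of (1)–(7) met; (S) and (T) are kernel
theorems from tree names — Kollár 1.101 chain / curve resolution; (Q) the J-2 input from quasi-excellence): THE
REFINED SEPARATING LAW WITH MEMORY — the object `RefStage` / `refHop` / `refRun` (g26's separating run on g25's
`Stage`, plus a PENDING old closure: when the separating hop cannot fire because the reduced closure of the bad
locus is IRREGULAR but a CURVE (`CurveFrozen`), the refined hop RESOLVES that closure — blow up `singCentreOf` =
𝓘(Sing(closure bad)), carry the strict closure as memory (`RefStage.resolve`), repeat while the carried closure is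
singular, then EXIT (`RefStage.exit`) and hand back to the separating hop), letters `RefMoves` / `RefTerminates`
[DECIDED] | `RefFrozen` [kind F-surface] | `RefPerpetual` [kind P′] (disjoint, exhaustive, hypothesis-free:
`ref_trichotomy`, `not_refTerminates_iff`); (S) `singLocusOf_finite` + `isClosed_singLocusOf` (the singular locus of
a reduced curve closure is finite and closed — quasi-excellence J-2 via
`IsQuasiExcellentRing.isReduced_adicCompletion_iff`, Hilbert–Samuel isolatedness), (R) permissibility
`support_singCentreOf_subset` , (T) `exists_reducedRegular_presolveRun` (finitely many point blow-ups make the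
carried reduced curve closure REGULAR — embedded curve resolution by the tree's one-dimensional blow-up tower
theorem, `Literature…OneDimensionalBlowupTowerProof`), the engine `wor_of_refTerminatesAt (h5 : SeqDimFour 5 n)` by
induction on the refined height; EXACT hypothesis-free carve `e1TopSepHeavy_iff_refHeavy_refTame : E1TopSepHeavy ↔
E1TopRefHeavy ∧ E1TopSepHeavyRefTame`, decided half `e1TopSepHeavyRefTame_of_five (h5 : E 5)`, RE-LOCATION
`e1TopSepHeavy_iff_e1TopRefHeavy (h5 : E 5)` (+ the whole column chain `e1TopRunHeavy_iff_` / `e1TopChainHeavy_iff_`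
/ `e1TopDeltaHeavy_iff_` / `e1TopHeavy_iff_` / `e1TopNoAbs_iff_` / `e_one_iff_e1TopRefHeavy`); split by kind
`e1TopRefHeavy_iff_frozen_perpetual : E1TopRefHeavy ↔ E1TopRefFrozen ∧ E1TopRefPerpetual`; THE SUB-KIND F-curve of
g26's kind F IS ELIMINATED WHOLE (`SepFrozen.refMoves_of_dimLEOne`: a run frozen AT A CURVE moves at that level), C×
(g26's kind-F inhabitant `z³+t⁴+u⁴w⁴`, char 3) DECIDED at refined height 4 (certificates file).  Located residual
after g27 = `E1TopRefHeavy` = kind F-surface `E1TopRefFrozen` [NO INHABITANT] ∧ kind P′ `E1TopRefPerpetual`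
[UNDECIDED · no inhabitant].  Landing orders = the lens's plan `HOME/decomp-res-lens-6/g27/NEXT-g28.md` (8e7949e1)
§4, endorsed by the critic rider INBOX :1315 (2026-08-31T09:51:49Z): (A)–(D) `DeltaCutRef*` = header + §RefDefs +
§RefLaw | §RefSing + §RefStrict | §RefTower | §RefEngine (the plan's file (A) alone is 481 lens lines > the tree's
400-line cap, so the group (A)–(D) is cut by the cap at declaration boundaries and numbered consecutively — sections
/ section `open`s replayed), (E) `DeltaCutRefCells` = §RefCells (cone-free aside home of `E1TopRefHeavy`,
`E1TopRefFrozen`, `E1TopRefPerpetual`), (F) `DeltaCutRefCertificates*` = the certificate file; all VERBATIM, `--kind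
proof --supports stmt-ResolutionOfSingularities-26971`, no `maxHeartbeats`, the HOME-only dupNamespace-linter line
dropped, imports exactly as the node on the first file and chained.  The `def … : Prop` tests / letters / cells
(`ReducedRegular`, `DimLEOne`, `CurveFrozen`, `RefMoves`, `RefTerminates`, `RefFrozen`, `RefPerpetual`, `PGood`,
`KLink`, `WORTopSepHeavyRefTame`, `WORTopRefHeavy`, `E1TopSepHeavyRefTame`, `E1TopRefHeavy`, `WORTopRefFrozen`,
`WORTopRefPerpetual`, `E1TopRefFrozen`, `E1TopRefPerpetual`) are THIS node's cells (cn26) — none is a vendored fact;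
the `Set` / `Closeds`-valued loci (`badClosure`, `singLocusOf`, `strictClosure`), the centre `singCentreOf` and the
refined-run data (`RefStage`, `RefHop`, `resolveStage`, `RefStage.resolve` / `exit` / `sep`, `refHop`, `refRun`,
`refRunHom`, `PStage`, `presolve`, `presolveRun`) are data-valued definitions.  ASIDE (critic rider: exactly ONE
switch this generation): `SCE1TopSepHeavy` (item 26925, rev 62) ⟶ ONE aside on `DeltaCutClasses.E1TopRefHeavy` (home
`DeltaCutRefCells`), re-location `e1TopSepHeavy_iff_e1TopRefHeavy (h5 : E 5)` — filed by the writer's route edit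
after (E) lands.

The lens header, verbatim:

> # RefCut (decomp-res-lens-6 · g27 · window of CRITIC-LEDGER row 196, deliverable «F-curve WHOLE»):
> # THE REFINED SEPARATING LAW WITH MEMORY, and C× decided
>
> NODE «RefCut».  Target = the column's located residual after g26, `DeltaCutClasses.E1TopSepHeavy` («for some base `n`-datum of
> `E 1`'s class NEITHER the canonical bad run NOR the separating run terminates»: kind F `SepFrozen` — an active prefix, then a
> NONEMPTY bad locus whose REDUCED CLOSURE is NOT regular, inhabited by C× = `z³ + t⁴ + u⁴w⁴` in characteristic `3` — or kind P
> `SepPerpetual` — active forever, no inhabitant known; item stmt-…-26971, route MaxContactCut).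
>
> ## The news of this node: the SUB-KIND F-curve of kind F IS ELIMINATED WHOLE, by a law WITH MEMORY
>
> Sub-kind F-curve (stated in advance by mechanism, row 196) := the separating run freezes at a level whose (reduced, irregular)
> bad-locus closure has dimension `≤ 1` (`CurveFrozen`; C×: closure bad₀ = `V(z,t,u·w)`, the `u`- and `w`-axes crossing at the
> wild origin, `Cx_sepFrozen_certificate`).  WHY g26 freezes: step 1 of the separating hop needs a REGULAR reduced
closure.  WHY NO
> MEMORYLESS REPAIR: «blow up `Sing(closure bad)`, recompute the bad locus upstairs» re-creates a NODAL closure — for C× the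
> closure of bad₁ is `ũ ∪ L ∪ w̃`, the strict transforms of the two axes now joined THROUGH the new exceptional top line `L`
> (chart `u`: `Cx_A_chart_u_top` / `Cx_A_chart_u_lines`, the non-prime ideal of `Cx_closure_not_prime` again), so a memoryless
> resolve-then-recompute rule cycles or re-freezes, and by the FAMILY RULE (rows 190/196) any memoryless re-lettering of kind F
> is 0-weight.  The repair is MEMORY: once a resolving phase starts, the run carries the STRICT TRANSFORM of the frozen closure
> and finishes resolving IT (ignoring the recomputed bad locus) before handing back to g26's separating hop.
>
> ## The law: the REFINED HOP on stages WITH MEMORY `RefStage = ⟨base : Stage, pending : Option (Closeds base.Y)⟩`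
>
> Canonical, choice-free (`refRun` is `Nat.rec` on `refHop`); positive-dimensional reduced centres; «pending closure first»:
> * `pending = some S` (a RESOLVING PHASE is under way; `S` = the current strict transform of the frozen closure, a curve inside
>   the top locus): if `S_red` is REGULAR (`ReducedRegular S`) → EXIT: blow up `𝓘(S)` (g26's step-1 move on the now-regular old
>   closure), `pending := none`; else → RESOLVE: blow up the REDUCED FINITE set `Sing(S_red)` (`singCentreOf S`), `pending :=
>   strictClosure S` (the closure of `π⁻¹(S ∖ Sing S_red)`, the strict transform).
> * `pending = none`: if the level is CURVE-FROZEN (`CurveFrozen`: bad ≠ ∅, reduced closure irregular, `DimLEOne`) →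
RESOLVE with
>   `S := badClosure` (the memory STARTS); otherwise g26's `sepHop` VERBATIM (active: step 1 (+ step 2); inactive: stay).
> PERMISSIBILITY IS PROVED for every branch (`refHop_facts`, `blowup_facts`): the RESOLVE centre `𝓘(Sing S_red)` is
a FINITE set of
> CLOSED points ((S) `singLocusOf_finite`: `S_red` is reduced, Noetherian, quasi-excellent
(`Stacks07QW_field_holds`) of dimension
> `≤ 1`, so its singular locus is closed (`regularLocus_of_isQuasiExcellent`, J-2) and misses every generic point (a reduced
> zero-dimensional local ring is a field), hence has dimension `≤ 0` and is finite —
`topologicalKrullDim_lt_of_forall_exists_specializes`,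
> `finite_of_topologicalKrullDim_le_zero`), a regular subscheme (`isRegular_subscheme_singCentreOf`, by g24's
> `isRegular_subscheme_vanishingIdeal_finset`) inside `S ⊆ {ord = n}`; the EXIT centre `𝓘(S)` is regular by the test
and inside the
> top locus because `S ⊆ support` is an INVARIANT of the phase (`strictClosure_subset_support`: off the centre the
order does not drop,
> `IsBlowup.idealOrder_controlledTransform_of_not_mem`, and the top locus is closed, `orderUSC_holds`); `DimLEOne`
is an invariant too
> (`dimLEOne_strictClosure`: `IsBlowup.topologicalKrullDim_le_of_isLocallyNoetherian`,
`topologicalKrullDim_subspace_le`); base / datum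
> upstairs by `baseStable_holds` / `isDatum_transform_blowup`; the `sep` branch cites g26's
`support_badClosureCentre_subset_support` /
> `support_oldTopCentre_subset_support`.
> (T) THE PENDING PHASE IS FINITE (`refRun_pending_phase_ends`; pure tower `presolveRun`,
`exists_reducedRegular_presolveRun`): restricted
> to `S_red` the resolving hop IS the blow-up of the reduced curve at its singular points (§RefStrict:
`strictTransformIdeal_vanishingIdeal_eq_of_closeds`,
> `exists_resolveHom` — the strict transform of `𝓘(S)` is `𝓘(strictClosure S)`, `strictTransformIdeal_eq_closure`,
reducedness upstairs
> `IsBlowup.isReduced_of_isReduced`); a singular point upstairs lies over a singular point downstairs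
(`IsBlowup.isIso_stalkMap_of_not_mem_support`
> off the centre), the two local rings linked by an `𝔪`-centred blow-up (`KLink`, `exists_kLink_presolve`,
`exists_chain_presolveRun`); the
> singular points of `S_red` are finitely many (`finite_compl_regularLocus`), so an endless phase would put chains
of unbounded length of
> NON-regular local rings over one singular point `c`, against **Kollár 2007 Thm. 1.101** for the reduced,
essentially-of-finite-type,
> one-dimensional local ring `𝒪_{S_red,c}` (reduced completion: `IsQuasiExcellentRing.isReduced_adicCompletion_iff`
+ `Stacks07QW_field_holds`)
> — TREE THEOREM `Kollar2007_thm_1_101_localChain_holds`, used BY NAME, nothing re-typed.  So every resolving phase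
reaches a level with
> `S_red` regular, where the hop EXITS (`refRun_curveFrozen_exits`).
> LETTERS (`RefMoves R` := `pending ≠ none ∨ SepActive ∨ CurveFrozen`): `RefTerminates` (moves on a prefix, then `pending = none` and an
> EMPTY bad locus) | `RefFrozen` (moves on a prefix, then `pending = none`, bad ≠ ∅, reduced closure IRREGULAR and
NOT of dimension `≤ 1`:
> kind F-surface) | `RefPerpetual` (moves forever: kind P′); trichotomy + exclusivity by `Nat.find`
(`ref_trichotomy`, `not_refTerminates_iff`,
> `not_refMoves_iff`, `refRun_eq_of_not_moves`).  THE SUB-KIND THEOREM, BY NAME: on a g26-active prefix `refRun = sepRun`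
> (`refRun_eq_sepRun_of_active`), so `SepTerminates.refTerminates` (g26-DECIDED ⊆ g27-DECIDED, same height),
`SepPerpetual.refPerpetual`
> (kind P ⊆ kind P′), `SepFrozen.refFrozen_of_not_dimLEOne` (F-surface stays frozen), and `SepFrozen.refMoves_of_dimLEOne` =
> `sepFrozen_curve_refMoves`: a run frozen AT A CURVE MOVES at that level — the letter «frozen at a curve» has NO
refined inhabitant; with
> (S)+(T) `refRun_curveFrozen_exits`: the phase it starts ENDS (pending = none again) finitely many levels later.
> ENGINE: ONE theorem for ALL refined heights from `SeqDimFour 5 n` (`wor_of_refTerminatesAt`, induction on the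
height generalising the
> ref-stage and its pending invariant `DimLEOne S ∧ S ⊆ support`; one `CentreSeq.cons` (`wor_cons`) per resolve /
exit hop, g26's one or two
> per separating hop; `wor_of_refTerminates`).
> CELLS (§RefCells): the decided `WORTopSepHeavyRefTame n` and the residual `WORTopRefHeavy n` carve g26's residual
`WORTopSepHeavy n`
> HYPOTHESIS-FREE with its binders VERBATIM (`worTopSepHeavy_iff_refHeavy_refTame`,
`e1TopSepHeavy_iff_refHeavy_refTame`); the decided side
> is PROVED from five (`worTopSepHeavyRefTame_of_five`, `e1TopSepHeavyRefTame_of_five`); RE-LOCATION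
`e1TopSepHeavy_iff_e1TopRefHeavy (h5 : E 5)`
> (`worTopSepHeavy_iff_worTopRefHeavy`) with the edges BY TREE NAMES down to `E 1` (`e1TopRunHeavy_iff_e1TopRefHeavy`,
> `e1TopChainHeavy_iff_e1TopRefHeavy`, `e1TopDeltaHeavy_iff_e1TopRefHeavy`, `e1TopHeavy_iff_e1TopRefHeavy`,
`e1TopNoAbs_iff_e1TopRefHeavy
> (hSC : SubfieldContactAbs) (h5 : E 5)`, `e_one_iff_e1TopRefHeavy`); the residual splits hyp-free into kind F-surface ∨ kind P′
> (`worTopRefHeavy_iff_surface_perpetual`, `e1TopRefHeavy_iff_surface_perpetual`) and reads intrinsically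
(`worTopRefHeavy_iff_intrinsic`:
> «weak resolution for every base `n`-datum whose bad run, separating run and refined run all fail to terminate»).
>
> ## Inhabitants (ring-level LEVEL certificates: `RefCutCertificates.lean`, §RefCertificates, over any field of
characteristic `3`)
>
> STRICT: C× is g26-RESIDUAL (kind F: `Cx_sepFrozen_certificate`, tree) and g27-DECIDED at REFINED HEIGHT 4 — R0
`CurveFrozen`, RESOLVE the
> origin (`Cx_R0_certificate`) · R1 the pending `C̃ = ũ ⊔ w̃` is regular although closure bad₁ = `ũ ∪ L ∪ w̃` is
nodal: EXIT (`Cx_R1_certificate`)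
> · R2 bad₂ = `L̃ ≅ ℙ¹` regular, nothing pending: separating hop (`Cx_R2_certificate`) · R3 top₃ = `λ ∪ λ' ∪ (μ ∪
ν)`, bad₃ = the finitely many
> points `Q` (`h(β) = β⁴+1 = 0` on `λ`) and `Q₀` (`β = ∞`) (+ mirror), at each of which the germ is LITERALLY P∞
(`Cx_C_isPinf`, `Cx_C_isPinf_b`
> with the étale coordinates `h`, `γ(1+γ⁴)`: `Cx_h_separable`, `Cx_gamma_separable`): separating hop, step 1 the
points, step 2 `λ̃ ⊔ λ̃' ⊔ (μ ∪ ν)~`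
> (`Cx_R3u_certificate`, `Cx_R3b_certificate`) · R4 bad₄ = ∅ (`Cx_R4_certificate`, `Cx_R4nu_certificate`, and P∞'s landed
> `Pinf_sepHeightOne_certificate` over `Q`, `Q₀`).  P∞ itself is refined-decided at height 1
(`SepTerminates.refTerminates`).  Kind F-surface:
> NO inhabitant known or claimed.  Kind P′: NO inhabitant known or claimed (never «expected empty»: it contains
g26's kind P, the rd-4 heart).
> HONEST CEILING (priced 0): F-surface WHOLE = a canonical embedded resolution of the (reduced, non-isolated)
SURFACE closure of the bad locus
> inside the ambient regular fourfold run as a sub-law — a CossartJannsenSaito2020-size port (functorial embedded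
resolution of excellent
> surfaces, their Thm. 1.2 / §5–§6), not a session law; P′ WHOLE needs an invariant decreasing along perpetual separating runs.
>
> ## FAMILY RULE after «RefCut» (critic row 196, binding for g28; cn28-style)
>
> The memory axis is a CLOCK like the run and centre-law axes: further pending-phase recipes (other resolution
orders for the pending curve,
> componentwise exits, resolving surfaces «a bit», normal-crossings bookkeeping of old exceptional components) earn
credit ONLY if the kernel
> law ELIMINATES kind F-surface WHOLE or kind P′ WHOLE (or a whole structural sub-kind stated in advance by
mechanism, with a certified
> inhabitant, once) — never for re-cutting them into finer inhabited letters.  PRECISION OF THE LETTERS: a level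
with `pending = none`
> FREEZES iff bad ≠ ∅, the reduced closure of bad is NOT regular AND NOT of dimension `≤ 1`; a curve closure NEVER
freezes (it starts a phase,
> which provably ends); inside a phase the run always moves; an EMPTY bad locus with nothing pending is
`RefTerminates`.  All tests are GLOBAL
> (`Scheme.IsRegular`, `topologicalKrullDim`), canonical and choice-free.
>
> IMPORTS THE LANDED TREE ONLY — NO CARRY: g26's `Theorems/DeltaCutSep` · `DeltaCutSep2` · `DeltaCutSepCells`
(§SepDefs `sepHop`/`sepRun`/`SepActive`/
> `ClosureRegular`/`BadEmpty`, §SepLaw letters, §SepEngine `support_badClosureCentre_subset_support` /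
`support_oldTopCentre_subset_support` /
> `wor_of_sepTerminatesAt`'s hop lemmas, §SepCells cells and edges, `worTopSepHeavy_iff_intrinsic`; landed
2026-08-31T08:57Z); g25 `Stage`,
> `isLocallyNoetherian_of_isBase`, `topChainHeavy_of_not_runTerminates`; g24 `isDatum_transform_blowup`,
`isRegular_subscheme_vanishingIdeal_finset`;
> `TwistCutClasses.orderUSC_holds`, `baseStable_holds`; Literature `Kollar2007_thm_1_101_localChain_holds`
(OneDimensionalBlowupTowerProof),
> `Stacks07QW_field_holds` + `regularLocus_of_isQuasiExcellent` (QuasiExcellentSchemes / QuasiExcellentCurveDelta),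
`IsBlowup.idealOrder_controlledTransform_of_not_mem`,
> `IsBlowup.isIso_stalkMap_of_not_mem_support`, `IsBlowup.isReduced_of_isReduced` (RegularHomReduced),
`IsBlowup.topologicalKrullDim_le_of_isLocallyNoetherian`
> (BlowupReducedDimension), `strictTransformIdeal_eq_closure` / `strictTransformIdeal_vanishingIdeal_eq`
(StrictTransformSupport),
> `topologicalKrullDim_lt_of_forall_exists_specializes` / `finite_of_topologicalKrullDim_le_zero`
(KrullDimensionDrop, HilbertSamuelIsolatedSingularities),
> `IsQuasiExcellentRing.isReduced_adicCompletion_iff`.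
>
> Farm: `lean check` rc 0 · 0 errors · 0 sorries; axioms {propext, Classical.choice, Quot.sound} (see
`bc/Probe.lean`).  No `instance`, no
> `notation`, no `sorry`.  New `def`s are `Prop`-valued letters/cells/tests (`ReducedRegular`, `DimLEOne`,
`CurveFrozen`, `RefMoves`, `RefTerminates`,
> `RefFrozen`, `RefPerpetual`, `PGood`, `KLink`, the eight cells), `Set`/`Closeds`-valued loci (`badClosure`,
`singLocusOf`, `strictClosure`), the
> centre `singCentreOf`, and the refined-run data (`RefStage`, `RefHop`, `resolveStage`,
`RefStage.resolve/exit/sep`, `refHop`, `refRun`, `refRunHom`,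
> `PStage`, `presolve`, `presolveRun`) under `Theorems`.
> (Sources: Hironaka1964; Kollar2007 Thm. 1.101; Lipman1978 §1; CossartJannsenSaito2020 §5–§6; CossartPiltant2019;
EGAIV2 §7.8 (quasi-excellence,
> J-2); BierstoneGrigorievMilmanWlodarczyk2011 §3.)

## This file

§RefDefs — THE REFINED SEPARATING RUN WITH MEMORY (data + letters): `badClosure`, `singLocusOf` / `singCentreOf` (𝓘
of the singular locus of a closed set's reduced structure), tests `ReducedRegular` / `DimLEOne` / `CurveFrozen`, the
data `RefStage` (a g25 `Stage` + a PENDING old closure) / `RefHop` / `resolveStage` / `strictClosure` /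
`RefStage.resolve` · `exit` · `sep` / `refHop` (open Classical: resolve while the pending closure is singular, exit
when it is regular, else g26's separating hop, else — `CurveFrozen` — start resolving the bad closure) / `refRun` /
`refRunHom` / `RefStage.ofStage`, letters `RefMoves`, `RefTerminates` [DECIDED], `RefFrozen` [kind F-surface],
`RefPerpetual` [kind P′]; §RefLaw — `refHop_facts`, `refRun_succ` / `_eq_sepRun_of_active`, the trichotomy
`ref_trichotomy` / `not_refTerminates_iff` / `RefTerminates.not_refPerpetual` / `RefFrozen.not_refPerpetual`,
`refMoves_of_pending` / `_of_sepActive` / `_of_curveFrozen`, `not_refMoves_of_badEmpty` / `_of_surface`, THE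
SUB-KIND KILL `SepFrozen.refMoves_of_dimLEOne` and `SepFrozen.refFrozen_of_not_dimLEOne`,
`refRun_pending_phase_ends`; §RefSing — (S): `singLocusOf_finite`, `isClosed_singLocusOf`, `closure_singLocusOf_eq`,
`support_singCentreOf_subset` (R, permissibility), `badClosureCentre_eq_vanishingIdeal`; §RefStrict — the strict
closure under the resolving blow-up (`strictClosure_*`, `isReduced_` / dimension lemmas); §RefTower — (T): `PStage`
/ `presolve` / `presolveRun`, `PGood`, `KLink`, `exists_resolveHom`, `exists_chain_presolveRun`,
`exists_reducedRegular_presolveRun` (embedded resolution of the carried reduced curve closure by finitely many point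
blow-ups, from `Literature…OneDimensionalBlowupTowerProof`); §RefEngine — `wor_of_refTerminatesAt` (all heights,
induction on the refined height, `h5 : SeqDimFour 5 n`) and `wor_of_refTerminates`.  (The 400-line cap cuts this
group into 4 files; this first part carries: `badClosure`, `badClosureCentre_eq_vanishingIdeal`, `singLocusOf`,
`singCentreOf`, `ReducedRegular`, `DimLEOne`, `CurveFrozen`, `RefStage`, `RefHop`, `resolveStage`, `strictClosure`,
`RefStage.resolve`.)

[WRITER NOTE (decomp-res writer g13): file split only (tree files ≤ 400 lines; the plan's section groups, cut
further by the cap at declaration boundaries); namespace, sections, section `open`s / `variable`s and every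
declaration exactly as in the lens (the node's HOME-only dupNamespace-linter line is dropped — the library sets it;
`noncomputable section`, the two file-level `open` lines, `universe u` and the namespace-level `open
…TwistCutClasses` / `open …LightCutClasses` of the node are replayed in every file).]

(Sources: Hironaka1964; Kollar2007 Thm. 1.101; Lipman1978 §1; CossartJannsenSaito2020 §5–§6, Def. 3.13 / Thm. 3.14;
CossartPiltant2019 Prop. 2.6; EGAIV2 §7.8; BierstoneGrigorievMilmanWlodarczyk2011 §3; Hironaka1967; Giraud1975.)
-/

noncomputable section

open CategoryTheory CategoryTheory.Limits AlgebraicGeometry TopologicalSpace IsLocalRing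
open Literature.AlgebraicGeometry.Resolution

universe u

namespace Summit.ResolutionOfSingularities.ResolutionOfSingularities.Theorems.DeltaCutClasses

open Summit.ResolutionOfSingularities.ResolutionOfSingularities.Theorems.TwistCutClasses
open Summit.ResolutionOfSingularities.ResolutionOfSingularities.Theorems.LightCutClasses

section RefDefs

open Summit.ResolutionOfSingularities.ResolutionOfSingularities.Theorems
open WeakOrderReduction ForcedTowerClasses SubfieldContactClasses AbsoluteContactClasses PurityValveClasses
open Scheme.IdealSheafData (vanishingIdeal)

/-! ### §RefDefs — THE REFINED SEPARATING HOP (a STATE WITH MEMORY: the pending old closure) and ITS RUN -/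

/-- the Zariski closure of the bad locus of a stage, as a CLOSED SUBSET (g26's step-1 centre is its reduced ideal:
`badClosureCentre n N = 𝓘(badClosure n N)` by `rfl`). DEFINITION (support). -/
def badClosure (n : ℕ) (N : Stage) : Closeds N.Y := ⟨closure (badLocus N.Y N.I n), isClosed_closure⟩

/-- g26's step-1 centre IS the reduced ideal of the bad closure. [folklore] -/
theorem badClosureCentre_eq_vanishingIdeal (n : ℕ) (N : Stage) :
    badClosureCentre n N = vanishingIdeal (badClosure n N) := rfl

/-- **THE SINGULAR LOCUS of the REDUCED induced structure `V(𝓘(S))` on a closed subset `S ⊆ Y`**, read as a subset of `Y`: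
the image of the non-regular locus of the scheme `V(𝓘(S))` under its closed immersion. DEFINITION (support). -/
def singLocusOf {Y : Scheme.{0}} (S : Closeds Y) : Set Y :=
  (vanishingIdeal S).subschemeι.base '' (Scheme.regularLocus (vanishingIdeal S).subscheme)ᶜ

/-- **THE RESOLVING CENTRE of a pending closed subset `S`**: the REDUCED closed subscheme on the closure of the singular locus
of `S_red` (for a curve on a base scheme that locus is a finite set of closed points, so the closure is itself —
`closure_singLocusOf_eq`). DEFINITION (support). -/
def singCentreOf {Y : Scheme.{0}} (S : Closeds Y) : Y.IdealSheafData :=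
  vanishingIdeal ⟨closure (singLocusOf S), isClosed_closure⟩

/-- `ReducedRegular S` — the reduced induced structure `V(𝓘(S))` is a REGULAR scheme (the exit test of the pending phase).
DEFINITION (letter). -/
def ReducedRegular {Y : Scheme.{0}} (S : Closeds Y) : Prop := Scheme.IsRegular (vanishingIdeal S).subscheme

/-- `DimLEOne S` — the reduced induced structure `V(𝓘(S))` has (topological Krull) DIMENSION `≤ 1` (the «curve» test of the
refined law; tree usage `hdim : topologicalKrullDim C ≤ 1` of `QuasiExcellentCurveDelta`). DEFINITION (letter). -/
def DimLEOne {Y : Scheme.{0}} (S : Closeds Y) : Prop := topologicalKrullDim (vanishingIdeal S).subscheme ≤ 1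

/-- `CurveFrozen n N` — the level is g26-FROZEN AT A CURVE: NONEMPTY bad locus, IRREGULAR reduced closure, and that closure
has dimension `≤ 1` (the sub-kind F-curve of g26's kind F; C× = `z³ + t⁴ + u⁴w⁴` at level `0`). DEFINITION (letter). -/
def CurveFrozen (n : ℕ) (N : Stage) : Prop := ¬ BadEmpty n N ∧ ¬ ClosureRegular n N ∧ DimLEOne (badClosure n N)

/-- **A REFINED STAGE** — a g25 stage TOGETHER WITH ITS MEMORY: an optional PENDING closed subset (the strict transform of an
old irregular bad closure still being resolved; `none` = no pending phase). DEFINITION (the state of the refined run). -/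
structure RefStage where
  /-- the underlying g25 stage `(Y, 𝓘)` -/
  base : Stage
  /-- the pending old closure, if a curve-resolution phase is running -/
  pending : Option (Closeds base.Y)

/-- **A REFINED HOP** out of a refined stage: the next refined stage and the structure morphism of the underlying schemes.
DEFINITION (support). -/
structure RefHop (R : RefStage) where
  /-- the next refined stage -/
  next : RefStage
  /-- the structure morphism of the hop -/
  hom : next.base.Y ⟶ R.base.Y

/-- **THE RESOLVE STEP** at a pending closed subset `S`: blow up the resolving centre `𝓘(closure Sing S_red)` and pass to the
controlled transform `(π^*𝓘 : 𝓔ⁿ)`. DEFINITION (support). -/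
abbrev resolveStage (n : ℕ) (N : Stage) (S : Closeds N.Y) : Stage :=
  ⟨blowup (singCentreOf S), controlledTransform (blowup.π (singCentreOf S)) (singCentreOf S) N.I n⟩

/-- **THE NEW PENDING SET after a resolve step**: the TOPOLOGICAL STRICT TRANSFORM of `S` — the closure of
`π⁻¹(S ∖ closure Sing S_red)`. DEFINITION (support). -/
def strictClosure {N : Stage} (S : Closeds N.Y) : Closeds (blowup (singCentreOf S) : Scheme.{0}) :=
  ⟨closure ((blowup.π (singCentreOf S)).base ⁻¹' ((S : Set N.Y) \ closure (singLocusOf S))), isClosed_closure⟩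

/-- the RESOLVE hop of a refined stage at a closed subset `S` of its scheme: resolve step, pending := strict transform of `S`.
DEFINITION (support). -/
def RefStage.resolve (n : ℕ) (R : RefStage) (S : Closeds R.base.Y) : RefHop R :=
  { next := ⟨resolveStage n R.base S, some (strictClosure S)⟩, hom := blowup.π (singCentreOf S) }

end RefDefs

end Summit.ResolutionOfSingularities.ResolutionOfSingularities.Theorems.DeltaCutClasses
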